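import Summits.QuantumFields.YangMills.Theorems.ParabolicTrajectoryContinuumLimitOnTrajectoryUclDefs
import Literature.MathematicalPhysics.QuantumLattice.SchwartzHalfSpaceCutoffC

/-!
# Crux `ContinuumLimitOnTrajectory` (stmt-QuantumFields-10522), line `two-orbit-synchronisation` (seat c2):
# the main term of the core clustering estimate — part A: OS-variance reduction, windows, asymptotics

Helper file (`--supports stmt-QuantumFields-10522`) for the registered stub `stub_uclOfGap : UCLOfGap`, wave 2,
worker W2-MAIN. Bookkeeping consumed by the main-term bound `main_term_bound` (`…UclMain`):

* `osVar_le_norm_integral` — the OS variance is at most the reflected self-pairing: `osVar μ Θ X ≤ ‖∫ conj (X ∘ Θ) · X dμ‖`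
  (the subtracted vacuum term `|∫X|²` is non-negative);
* `integral_conj_osLeft_mul_osLeft`, `integral_conj_osRight_mul_osRight` — by the invariance of Wilson's torus measure
  under integer time shifts, the reflected self-pairings of the OS observables `Y = osLeft A c`, `Z = osRight B c m'` of
  `cov_eq_osCorr` (`…UclSlab`) are the plane-reflected self-pairings `∫ A · conj (A ∘ planeRefl (−c))`,
  `∫ B · conj (B ∘ planeRefl (m' − c))` that `VarBound` (`…UclDefs`) controls; hence (registered anchor
  `mainA_osVar_osLeft_le`, and `mainA_osVar_osRight_le`) `osVar Y`, `osVar Z` are dominated by these pairings;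
* `window_arith` — the integer/real bookkeeping of the lattice windows of the two pieces (shift `m' ≥ 0` with
  `a m' ≥ s₀/2 − 3`, slab width `w` with `m' + 2w ≤ L`, positions of the two reflection planes);
* supports, locus-avoidance and uniform Schwartz-norm bounds of the windowed pieces `lowMain`, `upMain` (half-space cutoff kit
  `SchwartzHalfSpaceCutoffB/C`);
* elementary real-variable glue: floor/ceiling sandwich after multiplying by the spacing, `√x ≤ x/16` for `x ≥ 256`, and
  `K (1 + t)^N e^{−ct} → 0`.

Nothing about Wilson's theory is asserted. Refs: Osterwalder–Seiler 1978 §2; Glimm–Jaffe 1987 §6.1, §19.7.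
-/

set_option autoImplicit false

open scoped SchwartzMap ComplexConjugate
open MeasureTheory Filter Topology Set
open Literature.MathematicalPhysics.QuantumFieldTheory Literature.MathematicalPhysics.QuantumLattice
open Literature.MathematicalPhysics.AQFT Literature.Probability.LatticeModels

noncomputable section

namespace Summit.QuantumFields.YangMills.Cruxes.ContinuumLimitOnTrajectory.TwoOrbitSynchronisation

/-! ## The OS variance and the reflected self-pairings -/

/-- **The OS variance is dominated by the reflected self-pairing**: `osVar μ Θ X ≤ ‖∫ conj (X (Θ ω)) · X ω dμ‖`
(`osVar = Re (∫ conj (X∘Θ) X) − |∫ X|²`). -/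
theorem osVar_le_norm_integral {Ω : Type*} [MeasurableSpace Ω] (μ : Measure Ω) (Θ : Ω → Ω) (X : Ω → ℂ) :
    osVar μ Θ X ≤ ‖∫ u, conj (X (Θ u)) * X u ∂μ‖ := by
  show ((∫ u, conj (X (Θ u)) * X u ∂μ) - conj (∫ u, X u ∂μ) * ∫ u, X u ∂μ).re ≤ _
  have h1 : (conj (∫ u, X u ∂μ) * ∫ u, X u ∂μ).re = ‖∫ u, X u ∂μ‖ ^ 2 := by
    rw [Complex.conj_mul', ← Complex.ofReal_pow, Complex.ofReal_re]
  rw [Complex.sub_re, h1]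
  nlinarith [Complex.re_le_norm (∫ u, conj (X (Θ u)) * X u ∂μ), sq_nonneg ‖∫ u, X u ∂μ‖]

section Pairings

variable {G : Type} [Group G] [TopologicalSpace G] [IsTopologicalGroup G] [CompactSpace G]
  [MeasurableSpace G] [BorelSpace G]

/-- **Reflected self-pairing of the left OS observable** `Y = osLeft A c` (`Y = conj ∘ A ∘ τ_c ∘ Θ'`):
`∫ conj (Y (Θ'U)) · Y U dμ_k = ∫ A U · conj (A (planeRefl (−c) U)) dμ_k` (shift the integration variable by `τ_c`). -/
theorem integral_conj_osLeft_mul_osLeft (r : LatticeRep G) (sch : SpeciesScheme (YMSpecies G)) (k : ℕ)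
    (A : GaugeConfig 4 (sch.side k) G → ℂ) (c : ℤ) :
    ∫ U, conj (osLeft sch k A c U.negReflect) * osLeft sch k A c U ∂(μW r sch k) =
      ∫ U, A U * conj (A (planeRefl sch k (-c) U)) ∂(μW r sch k) := by
  have h := integral_comp_timeShiftInt r.ρ (sch.β k) (sch.side k) c
    (fun U => A U * conj (A (planeRefl sch k (-c) U)))
  rw [← h]
  refine integral_congr_ae (Eventually.of_forall fun U => ?_)
  simp only [osLeft, planeRefl, neg_neg, timeShiftInt_timeShiftInt, neg_add_cancel, timeShiftInt_zero,
    WilsonSiteRP.negReflect_negReflect_config, Complex.conj_conj]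

/-- **Reflected self-pairing of the right OS observable** `Z = osRight B c m'` (`Z = B ∘ τ_c ∘ τ_{−m'}`):
`∫ conj (Z (Θ'U)) · Z U dμ_k = ∫ B U · conj (B (planeRefl (m' − c) U)) dμ_k` (shift the integration variable by `τ_{c−m'}`). -/
theorem integral_conj_osRight_mul_osRight (r : LatticeRep G) (sch : SpeciesScheme (YMSpecies G)) (k : ℕ)
    (B : GaugeConfig 4 (sch.side k) G → ℂ) (c : ℤ) (m' : ℕ) :
    ∫ U, conj (osRight sch k B c m' U.negReflect) * osRight sch k B c m' U ∂(μW r sch k) =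
      ∫ U, B U * conj (B (planeRefl sch k ((m' : ℤ) - c) U)) ∂(μW r sch k) := by
  have h := integral_comp_timeShiftInt r.ρ (sch.β k) (sch.side k) (c - m')
    (fun U => B U * conj (B (planeRefl sch k ((m' : ℤ) - c) U)))
  rw [← h]
  refine integral_congr_ae (Eventually.of_forall fun U => ?_)
  have h1 : -((m' : ℤ) - c) = c - m' := by ring
  have h2 : c + -(m' : ℤ) = c - m' := by ring
  simp only [osRight, planeRefl, timeShiftInt_timeShiftInt, h1, h2, sub_add_sub_cancel', sub_self, timeShiftInt_zero]
  ring

/-- **OS variance of the left OS observable** (registered anchor of this file): for `Y = osLeft A c`,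
`osVar μ_k Θ' Y ≤ ‖∫ A U · conj (A (planeRefl (−c) U)) dμ_k‖` — the plane-reflected self-pairing that `VarBound` controls. -/
theorem mainA_osVar_osLeft_le :
    ∀ {G : Type} [Group G] [TopologicalSpace G] [IsTopologicalGroup G] [CompactSpace G] [MeasurableSpace G] [BorelSpace G]
      (r : LatticeRep G) (sch : SpeciesScheme (YMSpecies G)) (k : ℕ) (A : GaugeConfig 4 (sch.side k) G → ℂ) (c : ℤ),
      osVar (μW r sch k) GaugeConfig.negReflect (osLeft sch k A c) ≤
        ‖∫ U, A U * (starRingEnd ℂ) (A (planeRefl sch k (-c) U)) ∂(μW r sch k)‖ := by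
  intro G _ _ _ _ _ _ r sch k A c
  rw [← integral_conj_osLeft_mul_osLeft r sch k A c]
  exact osVar_le_norm_integral _ _ _

/-- **OS variance of the right OS observable**: for `Z = osRight B c m'`,
`osVar μ_k Θ' Z ≤ ‖∫ B U · conj (B (planeRefl (m' − c) U)) dμ_k‖`. -/
theorem mainA_osVar_osRight_le (r : LatticeRep G) (sch : SpeciesScheme (YMSpecies G)) (k : ℕ)
    (B : GaugeConfig 4 (sch.side k) G → ℂ) (c : ℤ) (m' : ℕ) :
    osVar (μW r sch k) GaugeConfig.negReflect (osRight sch k B c m') ≤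
      ‖∫ U, B U * (starRingEnd ℂ) (B (planeRefl sch k ((m' : ℤ) - c) U)) ∂(μW r sch k)‖ := by
  rw [← integral_conj_osRight_mul_osRight r sch k B c m']
  exact osVar_le_norm_integral _ _ _

end Pairings

/-! ## The windowed pieces: supports, locus-avoidance, uniform Schwartz bounds -/

section Pieces

variable {p : ℕ}

/-- **Support of the lower window piece**: inside the support of `X` and the time window `[−ρ − 1, s₀/4 + 1]`. -/
theorem tsupport_lowMain_subset (ρ s₀ : ℝ) (X : 𝓢((Fin p → EuclideanSpace ℝ (Fin 4)), ℂ)) :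
    tsupport (lowMain ρ s₀ X : (Fin p → EuclideanSpace ℝ (Fin 4)) → ℂ) ⊆
      tsupport (X : (Fin p → EuclideanSpace ℝ (Fin 4)) → ℂ) ∩ {x | ∀ j, -ρ - 1 ≤ x j 0 ∧ x j 0 ≤ s₀ / 4 + 1} := by
  intro x hx
  obtain ⟨h1, h2⟩ := tsupport_cutGE_subset 0 (-ρ) (cutLE 0 (s₀ / 4) X) hx
  obtain ⟨h3, h4⟩ := tsupport_cutLE_subset 0 (s₀ / 4) X h1
  exact ⟨h3, fun j => ⟨h2 j, h4 j⟩⟩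

/-- **Support of the upper window piece**: inside the support of `Y` and the time window `[3s₀/4 − 1, s₀ + ρ + 1]`. -/
theorem tsupport_upMain_subset (ρ s₀ : ℝ) (Y : 𝓢((Fin p → EuclideanSpace ℝ (Fin 4)), ℂ)) :
    tsupport (upMain ρ s₀ Y : (Fin p → EuclideanSpace ℝ (Fin 4)) → ℂ) ⊆
      tsupport (Y : (Fin p → EuclideanSpace ℝ (Fin 4)) → ℂ) ∩ {x | ∀ j, 3 * s₀ / 4 - 1 ≤ x j 0 ∧ x j 0 ≤ s₀ + ρ + 1} := by
  intro x hx
  obtain ⟨h1, h2⟩ := tsupport_cutLE_subset 0 (s₀ + ρ) (cutGE 0 (3 * s₀ / 4) Y) hx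
  obtain ⟨h3, h4⟩ := tsupport_cutGE_subset 0 (3 * s₀ / 4) Y h1
  exact ⟨h3, fun j => ⟨h4 j, h2 j⟩⟩

/-- The lower window piece of a locus-avoiding function avoids the locus. -/
theorem AvoidsLocus.lowMain {X : 𝓢((Fin p → EuclideanSpace ℝ (Fin 4)), ℂ)} (h : AvoidsLocus X) (ρ s₀ : ℝ) : AvoidsLocus (lowMain ρ s₀ X) :=
  h.of_tsupport_subset fun _ hx => (tsupport_lowMain_subset ρ s₀ X hx).1

/-- The upper window piece of a locus-avoiding function avoids the locus. -/
theorem AvoidsLocus.upMain {Y : 𝓢((Fin p → EuclideanSpace ℝ (Fin 4)), ℂ)} (h : AvoidsLocus Y) (ρ s₀ : ℝ) : AvoidsLocus (upMain ρ s₀ Y) :=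
  h.of_tsupport_subset fun _ hx => (tsupport_upMain_subset ρ s₀ Y hx).1

variable (p)

/-- **Uniform Schwartz bound for the lower window piece**: `|lowMain ρ s₀ X|_M ≤ C |X|_M`, `C` independent of `ρ, s₀`. -/
theorem exists_bound_schwartzNorm_lowMain (M : ℕ) :
    ∃ C : ℝ, 0 ≤ C ∧ ∀ (ρ s₀ : ℝ) (X : 𝓢((Fin p → EuclideanSpace ℝ (Fin 4)), ℂ)),
      schwartzNorm M (lowMain ρ s₀ X) ≤ C * schwartzNorm M X := by
  obtain ⟨C₁, hC₁0, hC₁⟩ := exists_bound_schwartzNorm_cutGE (d := 4) (p := p) 0 M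
  obtain ⟨C₂, hC₂0, hC₂⟩ := exists_bound_schwartzNorm_cutLE (d := 4) (p := p) 0 M
  refine ⟨C₁ * C₂, mul_nonneg hC₁0 hC₂0, fun ρ s₀ X => ?_⟩
  calc schwartzNorm M (lowMain ρ s₀ X) ≤ C₁ * schwartzNorm M (cutLE 0 (s₀ / 4) X) := hC₁ _ _
    _ ≤ C₁ * (C₂ * schwartzNorm M X) := mul_le_mul_of_nonneg_left (hC₂ _ _) hC₁0
    _ = C₁ * C₂ * schwartzNorm M X := by ring

/-- **Uniform Schwartz bound for the upper window piece**: `|upMain ρ s₀ Y|_M ≤ C |Y|_M`, `C` independent of `ρ, s₀`. -/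
theorem exists_bound_schwartzNorm_upMain (M : ℕ) :
    ∃ C : ℝ, 0 ≤ C ∧ ∀ (ρ s₀ : ℝ) (Y : 𝓢((Fin p → EuclideanSpace ℝ (Fin 4)), ℂ)),
      schwartzNorm M (upMain ρ s₀ Y) ≤ C * schwartzNorm M Y := by
  obtain ⟨C₁, hC₁0, hC₁⟩ := exists_bound_schwartzNorm_cutLE (d := 4) (p := p) 0 M
  obtain ⟨C₂, hC₂0, hC₂⟩ := exists_bound_schwartzNorm_cutGE (d := 4) (p := p) 0 M
  refine ⟨C₁ * C₂, mul_nonneg hC₁0 hC₂0, fun ρ s₀ Y => ?_⟩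
  calc schwartzNorm M (upMain ρ s₀ Y) ≤ C₁ * schwartzNorm M (cutGE 0 (3 * s₀ / 4) Y) := hC₁ _ _
    _ ≤ C₁ * (C₂ * schwartzNorm M Y) := mul_le_mul_of_nonneg_left (hC₂ _ _) hC₁0
    _ = C₁ * C₂ * schwartzNorm M Y := by ring

end Pieces

/-! ## Real-variable glue -/

/-- Floor sandwich after multiplying by a positive spacing: `a ⌊y/a⌋ ≤ y < a ⌊y/a⌋ + a`. -/
theorem mul_floor_div_le_and_lt {a : ℝ} (ha : 0 < a) (y : ℝ) :
    a * (⌊y / a⌋ : ℝ) ≤ y ∧ y < a * (⌊y / a⌋ : ℝ) + a := by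
  constructor
  · have h := Int.floor_le (y / a)
    rw [le_div_iff₀ ha] at h
    linarith
  · have h := Int.lt_floor_add_one (y / a)
    rw [div_lt_iff₀ ha] at h
    linarith

/-- Ceiling sandwich after multiplying by a positive spacing: `y ≤ a ⌈y/a⌉ < y + a`. -/
theorem le_mul_ceil_div_and_lt {a : ℝ} (ha : 0 < a) (y : ℝ) :
    y ≤ a * (⌈y / a⌉ : ℝ) ∧ a * (⌈y / a⌉ : ℝ) < y + a := by
  constructor
  · have h := Int.le_ceil (y / a)
    rw [div_le_iff₀ ha] at h
    linarith
  · have h := Int.ceil_lt_add_one (y / a)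
    rw [← div_add_same ha.ne', lt_div_iff₀ ha] at h
    linarith

/-- **Window arithmetic of the main term.** With spacing `a`, time radius `R₀`, separation `s₀ ≥ 6`, far radius
`ρ ≥ 0`, `a (2R₀ + 4) ≤ 1` and the geometry `s₀ + ρ + 2 ≤ aL/8`: the lattice windows
`[α₁, α₂] = [⌈(−ρ−1)/a⌉ − R₀, ⌊(s₀/4+1)/a⌋ + R₀]` (lower piece) and
`[β₁ − 1, β₂] = [⌈(3s₀/4−1)/a⌉ − R₀ − 1, ⌊(s₀+ρ+1)/a⌋ + R₀]` (upper piece) admit a shift `m' = β₁ − α₂ − 4 ≥ 0` with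
`a m' ≥ s₀/2 − 3` and a slab width `w` with `m' + 2w ≤ L`, and the two reflection planes `α₂ + 2`, `β₁ − 2` sit at
physical times in `[0, s₀/4 + 2]`, `[0, 3s₀/4]`. -/
theorem window_arith {a s₀ ρ L : ℝ} {R₀ : ℕ} (ha : 0 < a) (hak : a * (2 * (R₀ : ℝ) + 4) ≤ 1) (hs₀ : 6 ≤ s₀) (hρ : 0 ≤ ρ)
    (hgeom : s₀ + ρ + 2 ≤ a * L / 8) :
    ∃ m' w : ℕ,
      (m' : ℤ) = (⌈(3 * s₀ / 4 - 1) / a⌉ - (R₀ : ℤ)) - 1 - (⌊(s₀ / 4 + 1) / a⌋ + (R₀ : ℤ)) - 3 ∧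
      (⌊(s₀ / 4 + 1) / a⌋ + (R₀ : ℤ)) - (⌈(-ρ - 1) / a⌉ - (R₀ : ℤ)) + 3 ≤ (w : ℤ) ∧
      (⌊(s₀ + ρ + 1) / a⌋ + (R₀ : ℤ)) - ((⌈(3 * s₀ / 4 - 1) / a⌉ - (R₀ : ℤ)) - 1) + 1 ≤ (w : ℤ) ∧
      (m' : ℝ) + 2 * (w : ℝ) ≤ L ∧
      s₀ / 2 - 3 ≤ a * (m' : ℝ) ∧
      (0 ≤ a * (((⌊(s₀ / 4 + 1) / a⌋ + (R₀ : ℤ) : ℤ) : ℝ) + 2) ∧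
        a * (((⌊(s₀ / 4 + 1) / a⌋ + (R₀ : ℤ) : ℤ) : ℝ) + 2) ≤ s₀ / 4 + 2) ∧
      (0 ≤ a * (((⌈(3 * s₀ / 4 - 1) / a⌉ - (R₀ : ℤ) : ℤ) : ℝ) - 2) ∧
        a * (((⌈(3 * s₀ / 4 - 1) / a⌉ - (R₀ : ℤ) : ℤ) : ℝ) - 2) ≤ 3 * s₀ / 4) := by
  have hR₀ : (0 : ℝ) ≤ R₀ := Nat.cast_nonneg _
  have haR : 0 ≤ a * R₀ := mul_nonneg ha.le hR₀
  set θlo₁ : ℝ := -ρ - 1 with hθlo₁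
  set θhi₁ : ℝ := s₀ / 4 + 1 with hθhi₁
  set θlo₂ : ℝ := 3 * s₀ / 4 - 1 with hθlo₂
  set θhi₂ : ℝ := s₀ + ρ + 1 with hθhi₂
  set α₁ : ℤ := ⌈θlo₁ / a⌉ - (R₀ : ℤ) with hα₁
  set α₂ : ℤ := ⌊θhi₁ / a⌋ + (R₀ : ℤ) with hα₂
  set β₁ : ℤ := ⌈θlo₂ / a⌉ - (R₀ : ℤ) with hβ₁
  set β₂ : ℤ := ⌊θhi₂ / a⌋ + (R₀ : ℤ) with hβ₂
  -- real sandwiches of the window ends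
  have eα₁ : (α₁ : ℝ) = (⌈θlo₁ / a⌉ : ℝ) - R₀ := by rw [hα₁]; push_cast; ring
  have eα₂ : (α₂ : ℝ) = (⌊θhi₁ / a⌋ : ℝ) + R₀ := by rw [hα₂]; push_cast; ring
  have eβ₁ : (β₁ : ℝ) = (⌈θlo₂ / a⌉ : ℝ) - R₀ := by rw [hβ₁]; push_cast; ring
  have eβ₂ : (β₂ : ℝ) = (⌊θhi₂ / a⌋ : ℝ) + R₀ := by rw [hβ₂]; push_cast; ring
  obtain ⟨fα₂l, fα₂u⟩ := mul_floor_div_le_and_lt ha θhi₁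
  obtain ⟨cα₁l, cα₁u⟩ := le_mul_ceil_div_and_lt ha θlo₁
  obtain ⟨cβ₁l, cβ₁u⟩ := le_mul_ceil_div_and_lt ha θlo₂
  obtain ⟨fβ₂l, fβ₂u⟩ := mul_floor_div_le_and_lt ha θhi₂
  have iα₂u : a * α₂ ≤ θhi₁ + a * R₀ := by rw [eα₂, mul_add]; linarith
  have iα₂l : θhi₁ - a + a * R₀ < a * α₂ := by rw [eα₂, mul_add]; linarith
  have iα₁u : a * α₁ < θlo₁ + a - a * R₀ := by rw [eα₁, mul_sub]; linarith
  have iα₁l : θlo₁ - a * R₀ ≤ a * α₁ := by rw [eα₁, mul_sub]; linarith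
  have iβ₁u : a * β₁ < θlo₂ + a - a * R₀ := by rw [eβ₁, mul_sub]; linarith
  have iβ₁l : θlo₂ - a * R₀ ≤ a * β₁ := by rw [eβ₁, mul_sub]; linarith
  have iβ₂u : a * β₂ ≤ θhi₂ + a * R₀ := by rw [eβ₂, mul_add]; linarith
  have iβ₂l : θhi₂ - a + a * R₀ < a * β₂ := by rw [eβ₂, mul_add]; linarith
  -- the shift
  have hm'0 : (0 : ℤ) ≤ β₁ - 1 - α₂ - 3 := by
    have h : (0 : ℝ) ≤ a * ((β₁ - 1 - α₂ - 3 : ℤ) : ℝ) := by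
      push_cast
      have e : a * ((β₁ : ℝ) - 1 - α₂ - 3) = a * β₁ - a * α₂ - 4 * a := by ring
      rw [e]; linarith
    exact_mod_cast (mul_nonneg_iff_of_pos_left ha).1 h
  set m' : ℕ := (β₁ - 1 - α₂ - 3).toNat with hm'def
  have hm' : (m' : ℤ) = β₁ - 1 - α₂ - 3 := Int.toNat_of_nonneg hm'0
  have hm'r : (m' : ℝ) = (β₁ : ℝ) - α₂ - 4 := by
    have e := congrArg (fun z : ℤ => (z : ℝ)) hm'
    push_cast at e
    linarith
  -- the width
  have hwA0 : (0 : ℤ) ≤ α₂ - α₁ + 3 := by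
    have h : (0 : ℝ) < a * ((α₂ - α₁ + 3 : ℤ) : ℝ) := by
      push_cast
      have e : a * ((α₂ : ℝ) - α₁ + 3) = a * α₂ - a * α₁ + 3 * a := by ring
      rw [e]; linarith
    exact_mod_cast ((mul_pos_iff_of_pos_left ha).1 h).le
  have hwB0 : (0 : ℤ) ≤ β₂ - β₁ + 2 := by
    have h : (0 : ℝ) < a * ((β₂ - β₁ + 2 : ℤ) : ℝ) := by
      push_cast
      have e : a * ((β₂ : ℝ) - β₁ + 2) = a * β₂ - a * β₁ + 2 * a := by ring
      rw [e]; linarith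
    exact_mod_cast ((mul_pos_iff_of_pos_left ha).1 h).le
  set w : ℕ := (α₂ - α₁ + 3).toNat + (β₂ - β₁ + 2).toNat with hwdef
  have hw : (w : ℤ) = (α₂ - α₁ + 3) + (β₂ - β₁ + 2) := by
    rw [hwdef]; push_cast; rw [Int.toNat_of_nonneg hwA0, Int.toNat_of_nonneg hwB0]
  have hwr : (w : ℝ) = (α₂ : ℝ) - α₁ + 3 + (β₂ - β₁ + 2) := by
    have e := congrArg (fun z : ℤ => (z : ℝ)) hw
    push_cast at e
    linarith
  refine ⟨m', w, hm', by omega, by omega, ?_, ?_, ⟨by linarith, by linarith⟩, ⟨by linarith, by linarith⟩⟩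
  · refine le_of_mul_le_mul_left ?_ ha
    rw [mul_add, hm'r, hwr]
    have e : a * ((β₁ : ℝ) - α₂ - 4) + a * (2 * ((α₂ : ℝ) - α₁ + 3 + (β₂ - β₁ + 2))) =
        -(a * β₁) + a * α₂ - 2 * (a * α₁) + 2 * (a * β₂) + 6 * a := by ring
    rw [e]; linarith
  · rw [hm'r]
    have e : a * ((β₁ : ℝ) - α₂ - 4) = a * β₁ - a * α₂ - 4 * a := by ring
    rw [e]; linarith

/-- `√x ≤ x / 16` once `256 ≤ x`. -/
theorem sqrt_le_div_sixteen {x : ℝ} (hx : 256 ≤ x) : Real.sqrt x ≤ x / 16 := by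
  have h0 : 0 ≤ x / 16 := by linarith
  calc Real.sqrt x ≤ Real.sqrt ((x / 16) ^ 2) := Real.sqrt_le_sqrt (by nlinarith)
    _ = x / 16 := Real.sqrt_sq h0

/-- **Exponential decay beats polynomial growth**: `K (1 + t)^N e^{−ct} → 0` as `t → ∞` (`c > 0`). -/
theorem tendsto_const_mul_pow_mul_exp_neg (K : ℝ) (N : ℕ) {c : ℝ} (hc : 0 < c) :
    Tendsto (fun t : ℝ => K * (1 + t) ^ N * Real.exp (-(c * t))) atTop (𝓝 0) := by
  have h1 : Tendsto (fun t : ℝ => c * (1 + t)) atTop atTop :=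
    (tendsto_atTop_add_const_left atTop 1 tendsto_id).const_mul_atTop hc
  have h2 := ((Real.tendsto_pow_mul_exp_neg_atTop_nhds_zero N).comp h1).const_mul (K * Real.exp c / c ^ N)
  rw [mul_zero] at h2
  refine h2.congr fun t => ?_
  simp only [Function.comp_apply]
  have hcN : c ^ N ≠ 0 := pow_ne_zero N hc.ne'
  have hE : Real.exp (-(c * (1 + t))) = Real.exp (-(c * t)) * (Real.exp c)⁻¹ := by
    rw [← Real.exp_neg, ← Real.exp_add]; ring_nf
  have hE0 : Real.exp c ≠ 0 := Real.exp_ne_zero c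
  rw [hE, mul_pow]
  field_simp

end Summit.QuantumFields.YangMills.Cruxes.ContinuumLimitOnTrajectory.TwoOrbitSynchronisation

end
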